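import Summits.Schanuel.Schanuel.Theorems.RootDecomp1KGeneric21

/-!
# RootDecomp1KSumFormBridge — lens 1, generation 41 «SUM-FORM BRIDGE»: the NAMED E-side input `SumFormExpPairMeasure` (CONJECTURE / IDEA-NEEDED, Mahler's problem in sum form) ⟹ a.i. (ℓ, e^ℓ) for every real Liouville ℓ ⟹ 33364's named first open cell (ℓ_b, ℓ_b²) — a REDUCTION (K-R27′), no cell credit — EDITION 2 (+ §9 the door (T⁺⁺) as a typed SOCKET) — part 1 (RootDecomp1KSumFormBridge01): §1 Liouville reals in denominator form + §2 PRODUCT form (theorem, from NW96) and SUM form (the named CONJECTURE input)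

PORT NOTE (census-1 gen 17, 2026-08-31): port of [HOME/decomp-schanuel-lens-1/g41/RootDecomp1KSumFormBridge.lean EDITION 2 sha256 f8db09bf…, 1674 l (edition 1 328349aa… 1093 l + header item 7 + §9, additions only; NOTE L1923, writer re-check L1924), import tree Generic21 only + SFprobe + SFctrl + NODE-g41.md + presearch_g41.txt; CLAIM L1882, critic ACK L1883 (RULING K-R27′: conjecture inputs are IDEA-NEEDED markers — a REDUCTION, NO cell credit; typing requirements (i)–(iv); payable door (T⁺⁺)), NODE L1914 / REQUEST L1915, critic VERDICT L1925 (crit g8: CLEARED AS A REDUCTION OF RECORD under K-R27′ — (ε) BOOKING GRANTED, CREDIT NONE, typing audit (i)–(iv) PASSES, PORT GO)]; own farm rc 0 · 0 warn · 0 sorry · axioms std.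
Split in six parts for the 400-line cap: 01 = §1 Liouville reals in denominator form + §2 the two E-side statements at bounded degree (`ProductFormExpPairMeasure` PROVED from NW96 Thm 1 by name; `SumFormExpPairMeasure` = the NAMED INPUT, a CONJECTURE def kept IN THE KERNEL — never a Literature fact, never `_holds`); 02 = §3 the ENGINE (Liouville extraction in the exponent at POLYNOMIAL quality, hypothesis-free; `maxHeartbeats 800000 in` carried as in Generic18); 03 = §4 the bridge + §5 the cells DECIDED MOD THE SUM FORM (33364's named cell (ℓ_b, ℓ_b²), the Liouville pair sector) + §6 the ladder; 04 = §7 the one-logarithm variant `SumFormLogMeasure` + §8 the minimal pointwise shape `SumFormExpPairMeasureAt` and the graded axis `GradedExpPairMeasure`; 05 = §9 (1/2) the one-shot core `pairApprox_core` + `liouvilleNumber_convergent`; 06 = §9 (2/2) the SOCKET `liouvilleNumber_sq_cell_of_graded` (any rung g with the inverse-factorial growth condition closes the named cell), `growth_of_bounded`, `growth_loglog`, `liouvilleNumber_sq_cell_of_graded_loglog`, `namedCell_socket_summary`.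
PORT EDITS: the three `set_option linter.*` lines dropped; one docstring added; one unused lambda binder in the proof of `namedCell_socket_summary` renamed `_` (linter); statements and proofs otherwise verbatim; the LIVE links (`… ↔ FiniteOrderLiouvilleSchanuel := Iff.rfl`, probes, controls) stay in the HOME probe. `--supports stmt-Schanuel-33364`; no census credit; nothing here proves Schanuel, 33364 or the sum form; rung 0. The lens's header follows.
-/

/-!
# RootDecomp1K — lens 1 (grading / quantitative ladder), generation 41: THE SUM-FORM BRIDGE

Target item: `FiniteOrderLiouvilleSchanuel` (stmt-Schanuel-33364, residual A₄ᵈ of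
`route-Schanuel-RootDecomp1K`), at its NAMED FIRST OPEN CELL `(ℓ_b, ℓ_b²)`, `ℓ_b = Σ_k b^{-k!}`
(Hyper16 `liouvilleNumber_sq_cell`: in scope, hypothesis-free; `sb_liouvilleNumber_sq_of_…`:
«IDEA-NEEDED leaf — would need an approximation measure … with the heights entering as a SUM»).

## What this file does (all sorry-free, standard axioms)

1. **TYPES the missing E-side input** as a closed `Prop` over the tree's own height machinery:
   `SumFormExpPairMeasure` — Nesterenko–Waldschmidt 1996 Thm 1 at bounded degree with the
   log-height entering LINEARLY (`exp(−κ(T,N)·L)`), next to `ProductFormExpPairMeasure`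
   (`exp(−κ(T,N)·L²)`), which is PROVED from the registered fact `NesterenkoWaldschmidt1996_thm_1`
   (`productForm_of_NW`, via the tree kernel `expPair_lower_bound_deg_height`).  The sum form is the
   problem Waldschmidt states open in print («replace the product (log a)(log b) by the sum»,
   Open Diophantine Problems, Moscow Math. J. 4 (2004), §3; arXiv:math/0312440 p. 5); it is a
   CONJECTURE here (a `def`, used only as the hypothesis `hSF`), never a Literature fact.
2. **PROVES the bridge** `SumFormExpPairMeasure → ∀ ℓ Liouville, AlgebraicIndependent ℚ ![ℓ, e^ℓ]`
   (`algebraicIndependent_exp_of_liouville`): a hypothesis-free ENGINE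
   `liouvillePairApprox_of_dependent[_gen]` (port of lens 6's log-square engine, Generic18, with the
   budget `exp(−i(log q)²)` relaxed to `q^{−i}`, fed by Mathlib's `Liouville` through the new
   denominator-form lemma `exists_rat_den_ge_of_liouville`) produces, from an algebraic relation
   between `ℓ` and `e^ℓ`, simultaneous approximations `|e^ℓ − α| + |ℓ − β| < q^{−m}` at bounded degree
   and height `≤ c log q` for every `m`; the sum form caps the exponent (`not_liouvillePairApprox_of_sumForm`).
3. **DECIDES, modulo the one named input, the whole first-open-cell family of 33364**:
   `SB 2 (ℓ_b, ℓ_b²)` for every `b ≥ 2` (`liouvilleNumber_sq_cell_of_sumForm`), `SB 2 (ℓ, ℓ²)` and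
   `SB 2 (ℓ, w)` for every Liouville `ℓ` (`sumFormCell_sq`, `sumFormCell_any`), every pair whose
   ℚ-span contains a real Liouville number (`sb_two_of_liouville_mem_span`), hence items 31077 and
   33364 at `n = 2` on that sub-scope (`coordLiouvilleSchanuel_two_of_real_liouville`,
   `finiteOrderLiouvilleSchanuel_two_of_real_liouville`).
4. **THE LADDER** (`namedCell_ladder`): product form = THEOREM (mod NW96) and provably insufficient at
   `ℓ_b` (tree: `not_logSqLiouville_liouvilleNumber`); sum form ⟹ product form; sum form ⟹ the cell.
   The grade where the theorems stop is ONE exponent: `L²` proved, `L¹` needed.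
5. **THE INPUT AS A ONE-LOGARITHM MEASURE** (§7): `SumFormLogMeasure` — `|λ − β| ≥ exp(−κ(T,N)·L)`
   for `λ ≠ 0` a logarithm of an algebraic `α` and an ALGEBRAIC coefficient `β` (bounded degree,
   heights `≤ L`), i.e. the `u = λ` slice of the pair form (`logMeasure_of_sumForm`: pair ⟹ log,
   so the log form is the formally WEAKER typed input); it still decides every cell above
   (`not_liouvillePairApprox_of_logMeasure`, needing only `e^u ≠ 1`; `exists_log_near` chooses the
   logarithm next to `u`; `algebraicIndependent_exp_of_liouville_log`,
   `liouvilleNumber_sq_cell_of_logMeasure`, `namedCell_inputs`).  Shape in print: Waldschmidt,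
   Cetraro lectures (LNM 1819) §4.1, (4.3) Mahler `|e^b − a| ≥ a^{−c log log a}`, Conjecture 4.1
   `a^{−c}`, Theorem 4.2 (= NW96, product `(log A)(log B)`), «any further improvement … seems to
   require a new idea».  The converse log ⟹ pair is NOT claimed (its `α = 1` corner is Liouville's
   inequality for `β`, not typed here).
6. **TYPING REQUIREMENTS** (§8, critic K-R27′ (3)): the MINIMAL pointwise shape
   `SumFormExpPairMeasureAt u` (`∀ N, ∃ κ(u,N), …`; uniform ⟹ pointwise, `sumFormAt_of_sumForm`)
   already carries the bridge (`not_liouvillePairApprox_of_sumFormAt`,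
   `algebraicIndependent_exp_of_liouville_at`, `liouvilleNumber_sq_cell_of_sumFormAt` — the named
   cell from the statement AT THE SINGLE POINT `u = ℓ_b`); and the GRADED AXIS
   `GradedExpPairMeasure g` (exponent `κ·L·g(L)`): `g ≡ 1` ⟺ sum form, `g = id` ⟺ product form
   (`graded_one_iff`, `graded_id_iff`), monotone in `g` (`graded_mono`), bounded `g` ⟹ sum form ⟹
   the cell, `g ≤ id` ⟹ product form (`namedCell_axis`).  The rung table (which unbounded `g`
   reaches which Liouville class) is NODE-g41.md §3.
7. **THE DOOR (T⁺⁺) AS A TYPED SOCKET** (§9): the engine's ONE-SHOT CORE with the exponent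
   bookkeeping exposed (`pairApprox_core[_real]`, hypothesis-free: output exponent
   `E = (Ψ − (D+2)·log q)/K` for input exponent `Ψ`, `K, D` the degrees of the relation), the
   convergents of `ℓ_b` (`liouvilleNumber_convergent`: exponent `k` at scale `log q ≤ k!·log b`), and
   the SOCKET `algebraicIndependent_liouvilleNumber_exp_of_graded` / `liouvilleNumber_sq_cell_of_graded`:
   `GradedExpPairMeasure g` for ANY non-negative monotone rung `g` with the inverse-factorial growth
   condition along the convergent scales (`∀ C, ∀ c > 0, ∀ k₀, ∃ k ≥ k₀, C(1 + g(1 + c·k!·log b)) ≤ k`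
   — every `g(L) = o(log L / log log L)`) decides the named cell; CERTIFIED instances: bounded `g`
   (`growth_of_bounded`) and the UNBOUNDED rung `g(L) = log(1 + log L)` (`growth_loglog`,
   `liouvilleNumber_sq_cell_of_graded_loglog`); `namedCell_socket_summary`.  A PROVED rung of that
   growth plugs into the socket by `exact`; none is known (proved: `g = L` only).

## What is NOT claimed
No progress on the sum form itself; no cell is decided hypothesis-free here (the hypothesis-free
content is the engine, the denominator-form Liouville lemma, and the product-form repackaging).
The dependent WALL `(1, ℓ, ℓ²)` is NOT reached by a pair measure at bounded degree (clearing `e`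
from a relation `F(ℓ, e, e^ℓ) = 0` at `ℓ ≈ p/q` produces `e^{1/q}` of degree `q`): it would need the
multi-term sum-form measure for linear forms in `e^{a/q}` — recorded in NODE-g41.md, not typed here.
-/

noncomputable section

open Complex Polynomial Filter
open scoped Topology

namespace Summit.Schanuel.Schanuel.Theorems.RootDecomp1KSumFormBridge

open Summit.Schanuel.Schanuel.Theorems.RootDecomp1KHyper
open Summit.Schanuel.Schanuel.Theorems.RootDecomp1KHyper.HyperCell
open Summit.Schanuel.Schanuel.Theorems.RootDecomp1KGeneric
open Literature.NumberTheory.Transcendental (NesterenkoWaldschmidt1996_thm_1 weilHeight₁)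

variable {K : ℕ}

/-! ## §1  Liouville reals in denominator form (hypothesis-free) -/

/-- `1 ≤ log x` for `x ≥ 3`. -/
private theorem one_le_log_of_three_le {x : ℝ} (hx : 3 ≤ x) : 1 ≤ Real.log x := by
  rw [Real.le_log_iff_exp_le (by linarith)]
  have := Real.exp_one_lt_d9
  linarith

/-- Near an irrational real there are no rationals of small denominator: for every `M` some
`ε > 0` has `|x − r| < ε ⇒ M < r.den`. -/
theorem exists_eps_den_gt {x : ℝ} (hx : Irrational x) (M : ℕ) :
    ∃ ε : ℝ, 0 < ε ∧ ∀ r : ℚ, |x - r| < ε → M < r.den := by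
  have h : ∀ᶠ ε : ℝ in 𝓝 0, ∀ d ∈ {d : ℕ | d ≤ M}, ∀ a : ℤ, ε ≤ dist x (a / d) :=
    (Set.finite_le_nat M).eventually_all.2 fun d _ => hx.eventually_forall_le_dist_cast_div d
  obtain ⟨ε, hε, hεpos⟩ := ((h.filter_mono nhdsWithin_le_nhds).and
    (eventually_mem_nhdsWithin (s := Set.Ioi (0 : ℝ)) (a := 0))).exists
  refine ⟨ε, hεpos, fun r hr => ?_⟩
  by_contra hle
  rw [not_lt] at hle
  have h1 := hε r.den hle r.num
  rw [Real.dist_eq] at h1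
  have e : ((r.num : ℤ) : ℝ) / ((r.den : ℕ) : ℝ) = (r : ℝ) := (Rat.cast_def r).symm
  rw [e] at h1
  linarith

/-- **Denominator form of Mathlib's `Liouville`.**  A Liouville real has, for every `m`, a rational
approximant `r` in lowest terms with `den r ≥ m` and `|x − r| < exp(−m log den r) = (den r)^{−m}`
(POLYNOMIAL quality of every exponent — compare the tree's `LogSqLiouville` (`exp(−m (log q)²)`,
Generic17) and `LiouvilleOrder k` / `HyperLiouville` (`exp(−q^k)`, Generic13 / Hyper05)). -/
theorem exists_rat_den_ge_of_liouville {x : ℝ} (hx : Liouville x) (m : ℕ) :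
    ∃ r : ℚ, m ≤ r.den ∧ x ≠ r ∧ |x - r| < Real.exp (-((m : ℝ) * Real.log r.den)) := by
  obtain ⟨ε, hε0, hε⟩ := exists_eps_den_gt hx.irrational m
  obtain ⟨n₀, hn₀⟩ := exists_nat_gt (1 / ε)
  obtain ⟨a, b, hb, hne, hlt⟩ := hx (n₀ + m)
  have hb0 : (0 : ℤ) < b := zero_lt_one.trans hb
  have hb0r : (0 : ℝ) < b := by exact_mod_cast hb0
  have hb2r : (2 : ℝ) ≤ b := by exact_mod_cast (show (2 : ℤ) ≤ b by omega)
  set r : ℚ := (a : ℚ) / (b : ℚ) with hr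
  have hrcast : (r : ℝ) = (a : ℝ) / (b : ℝ) := by rw [hr]; push_cast; rfl
  -- `den r ∣ b`, so `1 ≤ den r ≤ b`
  have hdvd : ((r.den : ℕ) : ℤ) ∣ b := by
    rw [hr, ← Rat.divInt_eq_div]; exact Rat.den_dvd a b
  have hdenle : (r.den : ℝ) ≤ b := by
    have : ((r.den : ℕ) : ℤ) ≤ b := Int.le_of_dvd hb0 hdvd
    exact_mod_cast this
  have hden1 : (1 : ℝ) ≤ r.den := by exact_mod_cast r.den_pos
  have hden0 : (0 : ℝ) < r.den := by linarith
  -- `|x − r| < 1 / b^(n₀+m) ≤ 1 / 2^n₀ < ε`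
  have hxr : |x - r| < 1 / (b : ℝ) ^ (n₀ + m) := by rw [hrcast]; exact hlt
  have h2n : (1 : ℝ) / (b : ℝ) ^ (n₀ + m) ≤ 1 / (2 : ℝ) ^ n₀ := by
    have h1 : (2 : ℝ) ^ n₀ ≤ (b : ℝ) ^ n₀ := pow_le_pow_left₀ (by norm_num) hb2r n₀
    have h2 : (b : ℝ) ^ n₀ ≤ (b : ℝ) ^ (n₀ + m) :=
      pow_le_pow_right₀ (by linarith) (Nat.le_add_right n₀ m)
    exact one_div_le_one_div_of_le (by positivity) (h1.trans h2)
  have h2ε : (1 : ℝ) / (2 : ℝ) ^ n₀ < ε := by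
    have hn2 : (n₀ : ℝ) < (2 : ℝ) ^ n₀ := by exact_mod_cast Nat.lt_two_pow_self
    have hpos : (0 : ℝ) < (2 : ℝ) ^ n₀ := by positivity
    rw [div_lt_iff₀ hpos]
    rw [div_lt_iff₀ hε0] at hn₀
    nlinarith
  have hmden : m < r.den := hε r (hxr.trans_le (h2n.trans h2ε.le))
  refine ⟨r, hmden.le, by rw [hrcast]; exact hne, hxr.trans_le ?_⟩
  -- `1 / b^(n₀+m) ≤ 1 / den^m = exp(−m log den)`
  have e : Real.exp (-((m : ℝ) * Real.log r.den)) = 1 / (r.den : ℝ) ^ m := by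
    rw [Real.exp_neg, Real.exp_nat_mul, Real.exp_log hden0, one_div]
  rw [e]
  calc (1 : ℝ) / (b : ℝ) ^ (n₀ + m) ≤ 1 / (r.den : ℝ) ^ (n₀ + m) :=
        one_div_le_one_div_of_le (by positivity) (pow_le_pow_left₀ hden0.le hdenle _)
    _ ≤ 1 / (r.den : ℝ) ^ m := one_div_pow_le_one_div_pow_of_le hden1 (Nat.le_add_left m n₀)

/-- A Liouville real times a positive integer is Liouville (Mathlib's `LiouvilleWith.nat_mul`). -/
theorem liouville_nat_mul {ℓ : ℝ} (hℓ : Liouville ℓ) {M : ℕ} (hM : 1 ≤ M) :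
    Liouville ((M : ℝ) * ℓ) :=
  forall_liouvilleWith_iff.mp fun p => (hℓ.liouvilleWith p).nat_mul (by omega)

/-! ## §2  The two E-side statements at bounded degree: PRODUCT form (theorem) and SUM form (the named input) -/

/-- Binder package «`(α, β)` is a pair of non-zero algebraic numbers with `[ℚ(α, β) : ℚ] ≤ N` and
logarithmic heights `h(α), h(β) ≤ L`, `L ≥ 1`» — literally the binders of the tree's two-parameter
kernel `expPair_lower_bound_deg_height` (Generic17, NW 1996 Thm 1). -/
def AlgPairData (α β : ℂ) (N : ℕ) (L : ℝ) : Prop :=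
  α ≠ 0 ∧ β ≠ 0 ∧ IsAlgebraic ℚ α ∧ IsAlgebraic ℚ β ∧
    Module.finrank ℚ ↥(IntermediateField.adjoin ℚ ({α, β} : Set ℂ)) ≤ N ∧ 1 ≤ L ∧
    weilHeight₁ (IntermediateField.adjoin ℚ ({α, β} : Set ℂ)) (fun _ : Unit => α) ≤ L ∧
    weilHeight₁ (IntermediateField.adjoin ℚ ({α, β} : Set ℂ)) (fun _ : Unit => β) ≤ L

/-- **PRODUCT-FORM simultaneous approximation measure at bounded degree** (QUADRATIC in the
log-height): for `‖u‖ ≤ T`, `u ≠ 0`, and algebraic pairs of degree `≤ N`, heights `≤ L`: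
`|e^u − α| + |u − β| ≥ exp(−κ(T, N) · L²)`.  A THEOREM modulo the registered fact
`NesterenkoWaldschmidt1996_thm_1` (`productForm_of_NW` below = Generic17 P1 repackaged). -/
def ProductFormExpPairMeasure : Prop :=
  ∀ (T : ℝ) (N : ℕ), ∃ κ : ℝ, ∀ (u α β : ℂ) (L : ℝ), ‖u‖ ≤ T → u ≠ 0 → AlgPairData α β N L →
    Real.exp (-(κ * L ^ 2)) ≤ ‖cexp u - α‖ + ‖u - β‖

/-- **CONJECTURE / IDEA-NEEDED (typed as a `def`, never a Literature fact, never `_holds`; carried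
below only as the hypothesis `hSF`).  SUM-FORM simultaneous approximation measure at bounded degree
— THE NAMED E-SIDE INPUT** (LINEAR in the log-height): for `‖u‖ ≤ T`, `u ≠ 0`, and pairs `(α, β)` of
non-zero algebraic numbers with `[ℚ(α,β):ℚ] ≤ N` and absolute logarithmic WEIL heights
`h(α), h(β) ≤ L` (`weilHeight₁` = Mathlib `Height.logHeight₁`, the SAME binder package `AlgPairData`
as the product form; both heights bounded by ONE COMMON scale `L ≥ 1`):
`|e^u − α| + |u − β| ≥ exp(−κ(T, N) · L)`, the constant AFTER `T` and `N` (the pointwise-in-`u`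
shape `κ(u, N)`, which is all the bridge uses, is `SumFormExpPairMeasureAt`, §8).
PRINT ANCHORS (shape only — this general form is OURS: «no verbatim print source for the general
form; generalisation ours»): (a) Waldschmidt, Open Diophantine Problems (Moscow Math. J. 4, 2004;
arXiv:math/0312440 p. 5): for INTEGERS `a, b > 1`, «So far the best known estimate is
|a − e^b| > e^{−c(log a)(log b)}, so the problem is to replace in the exponent the product
(log a)(log b) by the sum log a + log b» — whence the NAME; (b) Waldschmidt, Cetraro lectures
(LNM 1819) p. 297, Conjecture 4.1 (Mahler's problem: `|e^b − a| ≥ a^{−c}`?  integers) and Theorem 4.2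
(the proved product bound = NW96 Thm 1 = tree fact `NesterenkoWaldschmidt1996_thm_1`, which gives
the PRODUCT form `exp(−κ L²)` here, `productForm_of_NW`).  Our statement is a GENERALISATION IN SHAPE
of (a)/(b) to arbitrary bounded `u` and algebraic `α, β` of bounded degree; it is LOGICALLY
INCOMPARABLE with Conjecture 4.1 (there `|u| = b → ∞` with `a, b ∈ ℤ`, here `‖u‖ ≤ T` with the
heights of `α, β → ∞`), so NO implication `SumForm → Conj 4.1` is claimed or typed.
SANITY ANCHORS (known slices): `u` algebraic with `β = u` reads `|e^u − α| ≥ exp(−κ L)` — the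
S-number measure of `e^u` (Mahler/Popken) for FIXED `u`; `u = log γ` with `α = γ` reads
`|log γ − β| ≥ exp(−κ L)` — Fel'dman's polynomial measure for FIXED `γ`; the conjecture's content is
the UNIFORMITY as the heights of `u`-side data grow, compared at the common scale `L` (which is also
what makes it survive the Baire remark «Liouville `ℓ` with `e^ℓ` Liouville exist»: a bound in
`h(α)` alone or `h(β)` alone would be false). -/
def SumFormExpPairMeasure : Prop :=
  ∀ (T : ℝ) (N : ℕ), ∃ κ : ℝ, ∀ (u α β : ℂ) (L : ℝ), ‖u‖ ≤ T → u ≠ 0 → AlgPairData α β N L →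
    Real.exp (-(κ * L)) ≤ ‖cexp u - α‖ + ‖u - β‖

/-- `c_NW₂` is monotone on `[0, ∞)`. -/
theorem cNW₂_mono {s t : ℝ} (hs : 0 ≤ s) (hst : s ≤ t) : cNW₂ s ≤ cNW₂ t := by
  unfold cNW₂; nlinarith

/-- **Rung 1 of the ladder (THEOREM mod NW96): the product form holds**, with
`κ(T, N) = 4 · c_NW₂(max T 0) · (N + 1)⁵` (Generic17 `expPair_lower_bound_deg_height`, `(1+L)² ≤ 4L²`). -/
theorem productForm_of_NW (hNW : NesterenkoWaldschmidt1996_thm_1) : ProductFormExpPairMeasure := by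
  intro T N
  refine ⟨4 * cNW₂ (max T 0) * ((N : ℝ) + 1) ^ 5, fun u α β L huT hu0 hd => ?_⟩
  obtain ⟨hα0, hβ0, hα, hβ, hD, hL1, hhα, hhβ⟩ := hd
  have hN1 : (1 : ℝ) ≤ (N : ℝ) + 1 := by linarith [(Nat.cast_nonneg N : (0 : ℝ) ≤ N)]
  have hDr : (Module.finrank ℚ ↥(IntermediateField.adjoin ℚ ({α, β} : Set ℂ)) : ℝ) ≤ (N : ℝ) + 1 := by
    have : (Module.finrank ℚ ↥(IntermediateField.adjoin ℚ ({α, β} : Set ℂ)) : ℝ) ≤ N := by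
      exact_mod_cast hD
    linarith
  have hlow := expPair_lower_bound_deg_height hNW hu0 hα0 hβ0 hα hβ hN1 hL1 hDr hhα hhβ
  refine le_trans (Real.exp_le_exp.mpr (neg_le_neg ?_)) hlow
  have hc0 : 0 ≤ cNW₂ ‖u‖ := (cNW₂_pos (norm_nonneg u)).le
  have hcT : cNW₂ ‖u‖ ≤ cNW₂ (max T 0) := cNW₂_mono (norm_nonneg u) (huT.trans (le_max_left _ _))
  have hN0 : (0 : ℝ) ≤ ((N : ℝ) + 1) ^ 5 := by positivity
  have hcT0 : 0 ≤ cNW₂ (max T 0) := (cNW₂_pos (le_max_right _ _)).le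
  have hprod0 : 0 ≤ cNW₂ (max T 0) * ((N : ℝ) + 1) ^ 5 := mul_nonneg hcT0 hN0
  have hsq : (1 + L) ^ 2 ≤ 4 * L ^ 2 := by nlinarith
  calc cNW₂ ‖u‖ * ((N : ℝ) + 1) ^ 5 * (1 + L) ^ 2
      ≤ cNW₂ (max T 0) * ((N : ℝ) + 1) ^ 5 * (4 * L ^ 2) := by gcongr
    _ = 4 * cNW₂ (max T 0) * ((N : ℝ) + 1) ^ 5 * L ^ 2 := by ring

/-- The sum form is a STRENGTHENING of the product form (`L ≤ L²` for `L ≥ 1`): the named input sits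
one rung ABOVE the theorem on the same ladder. -/
theorem productForm_of_sumForm (hSF : SumFormExpPairMeasure) : ProductFormExpPairMeasure := by
  intro T N
  obtain ⟨κ, hκ⟩ := hSF T N
  refine ⟨max κ 0, fun u α β L huT hu0 hd => ?_⟩
  have hL1 : 1 ≤ L := hd.2.2.2.2.2.1
  refine le_trans (Real.exp_le_exp.mpr (neg_le_neg ?_)) (hκ u α β L huT hu0 hd)
  have h0 : 0 ≤ max κ 0 := le_max_right _ _
  calc κ * L ≤ max κ 0 * L := mul_le_mul_of_nonneg_right (le_max_left _ _) (by linarith)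
    _ ≤ max κ 0 * L ^ 2 := mul_le_mul_of_nonneg_left (by nlinarith) h0

end Summit.Schanuel.Schanuel.Theorems.RootDecomp1KSumFormBridge

end
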